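import Mathlib
import Literature.AlgebraicGeometry.Resolution.FormalCoordinateChange
import Literature.AlgebraicGeometry.Resolution.FormalInverseFunction
import Literature.AlgebraicGeometry.Resolution.FormalShear
import Summits.ResolutionOfSingularities.ResolutionOfSingularities.Theorems.WeightedInvariantGlobalizeLocalDropCanonize

/-!
# Approximate `d`-th powers to all orders ⇒ exact `d`-th power (plane germs)

Crux `LocalWeightedDrop` (stmt-ResolutionOfSingularities-8899, route
ResolutionOfSingularities/WeightedInvariant), line `hasse-ridge-face-selection`, registered stub
`stub_approxPowerExact` of the skeleton `LocalWeightedDrop` (plane case of the local weighted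
resolution game; the analytic half of the key lemma "unbounded contact ⇒ pure `d`-th power").

For `f ∈ k[[x, y]]` (`x = X 0`, `y = X 1`, any field `k`) of order `d`: if for EVERY `N` there
are a unit `u_N`, a smooth germ `L_N` (`L_N(0) = 0`, some linear coefficient `≠ 0`) and `R_N`
of order `≥ N` with `f = u_N · L_N^d + R_N`, then `f = u · L^d` EXACTLY (`u` a unit, `L`
smooth): the set `{u · L^d}` is `𝔪`-adically closed.  Proof (the shears `T_ψ = (x, y + ψ)`,
the kill-`y` substitution `(x, 0)`, "in `x` only" = no `y`-monomials, and the graph form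
`graph` are in `Literature/AlgebraicGeometry/Resolution/FormalShear.lean`):
* `d = 0`: `f` is a unit; take `L = x`.
* COFINAL SLOT: WLOG `∂L_N/∂y(0) ≠ 0` for all `N` (a representation at level `max N N₀` is one
  at level `N`; if the `y`-slot fails from some `N₀` on, the `x`-slot works for all `N`, and the
  swap `(y, x)` — involutive, order preserving, exchanging the two linear coefficients — reduces
  to the `y`-slot, `main_slot_zero`).
* `approx_shear`: by the graph form, `T_{ψ_N} f = V_N · y^d + R'_N`, `V_N(0) ≠ 0`,
  `ord R'_N ≥ N`.
* `cauchy`: for two such, with `δ = ψ₂ - ψ₁`: `T_{ψ₂} f = T_δ (T_{ψ₁} f) =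
  (T_δ V₁)(y + δ)^d + T_δ R₁`; killing `y`: `(T_δ V₁)(x,0) · δ^d = R₂(x,0) - (T_δ R₁)(x,0)`
  has order `≥ N` and the first factor is a unit, so `ord δ^d ≥ N`, i.e. `d · ord δ ≥ N`.
* `main_slot`: `Ψ := lim ψ_N` coefficientwise (`coeff e Ψ = coeff e ψ_N` whenever
  `d · |e| < N`).  Then `T_Ψ f = T_ε (T_{ψ_N} f) = (T_ε V_N)(y + ε)^d + T_ε R'_N` with
  `ε = Ψ - ψ_N` of order `≥ N/d` and `(y + ε)^d ∈ y^d + (ε)`; so every coefficient of `T_Ψ f`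
  at an exponent `(i, j)` with `j < d` vanishes, `T_Ψ f = y^d · V`, and `V(0) ≠ 0` because
  `ord T_Ψ f = ord f = d`.  Finally `f = T_{-Ψ}(y^d · V) = (y - Ψ)^d · T_{-Ψ} V`.
-/

set_option linter.dupNamespace false -- mandated namespace of this single-conjunct summit

namespace Summit.ResolutionOfSingularities.ResolutionOfSingularities.Theorems

open Literature.AlgebraicGeometry.Resolution
open Literature.AlgebraicGeometry.Resolution.FormalShear

namespace ApproxPowerExact

open MvPowerSeries

variable {k : Type} [Field k]

/-! ### 1. Normalised approximations `T_{ψ_N} f = V_N · y^d + R'_N` -/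

/-- From a `y`-regular approximate `d`-th power representation at level `N` to a sheared one:
`T_ψ f = V · y^d + R'` with `ψ` in `x` only, `V(0) ≠ 0`, `ord R' ≥ N`. -/
theorem approx_shear {f : MvPowerSeries (Fin 2) k} {d : ℕ}
    (hrep : ∀ N : ℕ, ∃ u L R : MvPowerSeries (Fin 2) k, constantCoeff u ≠ 0 ∧
      constantCoeff L = 0 ∧ coeff (Finsupp.single 1 1) L ≠ 0 ∧ f = u * L ^ d + R ∧
      (N : ℕ∞) ≤ R.order) (N : ℕ) :
    ∃ ψ V R' : MvPowerSeries (Fin 2) k,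
      (∀ e : Fin 2 →₀ ℕ, e 1 ≠ 0 → coeff e ψ = 0) ∧ constantCoeff ψ = 0 ∧
      constantCoeff V ≠ 0 ∧ subst ![X 0, X 1 + ψ] f = V * X 1 ^ d + R' ∧
      (N : ℕ∞) ≤ R'.order := by
  obtain ⟨u, L, R, hu, hL0, hL1, hf, hR⟩ := hrep N
  obtain ⟨ψ, W, hψX, hψ0, hW0, hM⟩ := graph L hL0 hL1
  have hψs : HasSubst ![X 0, X 1 + ψ] := hasSubst_shear hψ0
  refine ⟨ψ, subst ![X 0, X 1 + ψ] u * W ^ d, subst ![X 0, X 1 + ψ] R, hψX, hψ0,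
    ?_, ?_, ?_⟩
  · rw [map_mul, map_pow, constantCoeff_subst_of_constantCoeff_zero _ (constantCoeff_shear hψ0)]
    exact mul_ne_zero hu (pow_ne_zero _ hW0)
  · conv_lhs => rw [hf]
    rw [subst_add hψs, subst_mul hψs, subst_pow hψs, hM]
    ring
  · exact hR.trans (order_le_order_subst' _ (constantCoeff_shear hψ0) _)

/-! ### 2. The Cauchy estimate -/

/-- CAUCHY ESTIMATE.  Two sheared representations `T_{ψᵢ} f = Vᵢ · y^d + Rᵢ` (`ψᵢ` in `x`
only, `V₁(0) ≠ 0`, `ord Rᵢ ≥ N`, `d ≥ 1`) have `ord (ψ₂ - ψ₁)^d ≥ N`. -/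
theorem cauchy {d N : ℕ} (hd : 1 ≤ d)
    {f ψ₁ ψ₂ V₁ V₂ R₁ R₂ : MvPowerSeries (Fin 2) k}
    (hψ₁ : ∀ e : Fin 2 →₀ ℕ, e 1 ≠ 0 → coeff e ψ₁ = 0)
    (hψ₁0 : constantCoeff ψ₁ = 0)
    (hψ₂ : ∀ e : Fin 2 →₀ ℕ, e 1 ≠ 0 → coeff e ψ₂ = 0)
    (hψ₂0 : constantCoeff ψ₂ = 0)
    (hV₁ : constantCoeff V₁ ≠ 0) (h₁ : subst ![X 0, X 1 + ψ₁] f = V₁ * X 1 ^ d + R₁)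
    (h₂ : subst ![X 0, X 1 + ψ₂] f = V₂ * X 1 ^ d + R₂)
    (hR₁ : (N : ℕ∞) ≤ R₁.order) (hR₂ : (N : ℕ∞) ≤ R₂.order) :
    (N : ℕ∞) ≤ ((ψ₂ - ψ₁) ^ d).order := by
  -- the kill-`y` family `κ = (x, 0)`
  obtain ⟨κ, hκ0, hκ1⟩ : ∃ a : Fin 2 → MvPowerSeries (Fin 2) k, a 0 = X 0 ∧ a 1 = 0 :=
    ⟨![X 0, 0], rfl, rfl⟩
  have hκc := constantCoeff_kill hκ0 hκ1
  have hks : HasSubst κ := hasSubst_of_constantCoeff_zero hκc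
  set δ := ψ₂ - ψ₁ with hδ
  have hδX : ∀ e : Fin 2 →₀ ℕ, e 1 ≠ 0 → coeff e δ = 0 := noY_sub hψ₂ hψ₁
  have hδ0 : constantCoeff δ = 0 := by rw [hδ, map_sub, hψ₁0, hψ₂0, sub_zero]
  have hδs : HasSubst ![X 0, X 1 + δ] := hasSubst_shear hδ0
  -- `T_{ψ₂} f = T_δ (T_{ψ₁} f)`
  have key : V₂ * X 1 ^ d + R₂ =
      subst ![X 0, X 1 + δ] V₁ * (X 1 + δ) ^ d + subst ![X 0, X 1 + δ] R₁ := by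
    rw [← h₂, show ψ₂ = δ + ψ₁ by rw [hδ, sub_add_cancel],
      ← shear_shear hψ₁ hδ0 hψ₁0 f, h₁, subst_add hδs, subst_mul hδs, subst_pow hδs,
      subst_X hδs, shearFamily_apply_one]
  -- kill `y`
  have lhs : subst κ (V₂ * X 1 ^ d + R₂) = subst κ R₂ := by
    rw [subst_add hks, subst_mul hks, subst_pow hks, subst_X hks, hκ1,
      zero_pow (by omega), mul_zero, zero_add]
  have rhs : subst κ (subst ![X 0, X 1 + δ] V₁ * (X 1 + δ) ^ d + subst ![X 0, X 1 + δ] R₁) =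
      subst κ (subst ![X 0, X 1 + δ] V₁) * δ ^ d + subst κ (subst ![X 0, X 1 + δ] R₁) := by
    rw [subst_add hks, subst_mul hks, subst_pow hks, subst_add hks, subst_X hks, hκ1,
      zero_add, subst_eq_self_of_noY hks hκ0 hδX]
  set w := subst κ (subst ![X 0, X 1 + δ] V₁) with hw
  have hw0 : constantCoeff w ≠ 0 := by
    rwa [hw, constantCoeff_subst_of_constantCoeff_zero _ hκc,
      constantCoeff_subst_of_constantCoeff_zero _ (constantCoeff_shear hδ0)]
  have hprod : w * δ ^ d = subst κ R₂ - subst κ (subst ![X 0, X 1 + δ] R₁) := by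
    rw [eq_sub_iff_add_eq, ← rhs, ← key, lhs]
  have hN : (N : ℕ∞) ≤ (w * δ ^ d).order := by
    rw [hprod]
    apply le_order_sub
    · exact hR₂.trans (order_le_order_subst' _ hκc _)
    · exact hR₁.trans ((order_le_order_subst' _ (constantCoeff_shear hδ0) _).trans
        (order_le_order_subst' _ hκc _))
  calc (N : ℕ∞) ≤ (w * δ ^ d).order := hN
    _ ≤ w⁻¹.order + (w * δ ^ d).order := le_add_self
    _ ≤ (w⁻¹ * (w * δ ^ d)).order := le_order_mul
    _ = (δ ^ d).order := by rw [← mul_assoc, MvPowerSeries.inv_mul_cancel w hw0, one_mul]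

/-! ### 3. The limit shear and the exact `d`-th power (`y`-regular slot) -/

/-- MAIN LEMMA (`y`-slot): if `f` of order `d ≥ 1` has, for every `N`, a `y`-regular
approximate representation `f = u · L^d + R` (`u(0) ≠ 0`, `L(0) = 0`, `∂L/∂y(0) ≠ 0`,
`ord R ≥ N`), then `f = u · L^d` exactly with `u(0) ≠ 0`, `L = y - Ψ(x)`. -/
theorem main_slot {f : MvPowerSeries (Fin 2) k} {d : ℕ} (hd : 1 ≤ d) (hfd : f.order = d)
    (hrep : ∀ N : ℕ, ∃ u L R : MvPowerSeries (Fin 2) k, constantCoeff u ≠ 0 ∧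
      constantCoeff L = 0 ∧ coeff (Finsupp.single 1 1) L ≠ 0 ∧ f = u * L ^ d + R ∧
      (N : ℕ∞) ≤ R.order) :
    ∃ u L : MvPowerSeries (Fin 2) k, constantCoeff u ≠ 0 ∧ constantCoeff L = 0 ∧
      (∃ i, coeff (Finsupp.single i 1) L ≠ 0) ∧ f = u * L ^ d := by
  classical
  -- normalised approximations, one for each level `N`
  choose ψ V R hψ hψ0 hV hTf hR using approx_shear hrep
  -- Cauchy: the coefficients of `ψ N` stabilise
  have hC : ∀ N M : ℕ, N ≤ M → ∀ e : Fin 2 →₀ ℕ, d * e.degree < N →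
      coeff e (ψ N) = coeff e (ψ M) := by
    intro N M hNM e he
    have h := coeff_eq_zero_of_le_order_pow (cauchy hd (hψ N) (hψ0 N) (hψ M) (hψ0 M) (hV N)
      (hTf N) (hTf M) (hR N) (le_trans (by exact_mod_cast hNM) (hR M))) e he
    rwa [map_sub, sub_eq_zero, eq_comm] at h
  -- the limit `Ψ`
  let Ψ : MvPowerSeries (Fin 2) k := fun e => coeff e (ψ (d * e.degree + 1))
  have hΨ : ∀ (N : ℕ) (e : Fin 2 →₀ ℕ), d * e.degree < N →
      coeff e Ψ = coeff e (ψ N) := by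
    intro N e he
    rw [coeff_apply]
    show coeff e (ψ (d * e.degree + 1)) = coeff e (ψ N)
    rw [hC (d * e.degree + 1) (max N (d * e.degree + 1)) (le_max_right _ _) e
      (Nat.lt_succ_self _), ← hC N (max N (d * e.degree + 1)) (le_max_left _ _) e he]
  have hΨX : ∀ e : Fin 2 →₀ ℕ, e 1 ≠ 0 → coeff e Ψ = 0 := by
    intro e he
    rw [hΨ (d * e.degree + 1) e (Nat.lt_succ_self _)]
    exact hψ _ e he
  have hΨ0 : constantCoeff Ψ = 0 := by
    rw [← coeff_zero_eq_constantCoeff_apply, hΨ 1 0 (by simp),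
      coeff_zero_eq_constantCoeff_apply]
    exact hψ0 1
  -- tails: `Ψ - ψ N` has order `≥ m` as soon as `d m ≤ N`
  have htail : ∀ N m : ℕ, d * m ≤ N → (m : ℕ∞) ≤ (Ψ - ψ N).order := by
    intro N m hm
    apply nat_le_order
    intro e he
    have he' : e.degree < m := by exact_mod_cast he
    rw [map_sub, hΨ N e (lt_of_lt_of_le (Nat.mul_lt_mul_of_pos_left he' hd) hm), sub_self]
  -- every coefficient of `F := T_Ψ f` off `y^d · k[[x, y]]` vanishes
  have hΨs : HasSubst ![X 0, X 1 + Ψ] := hasSubst_shear hΨ0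
  set F : MvPowerSeries (Fin 2) k := subst ![X 0, X 1 + Ψ] f with hF
  have hcoef : ∀ e : Fin 2 →₀ ℕ, e 1 < d → coeff e F = 0 := by
    intro e he1
    set m : ℕ := e.degree + 1 with hm
    set N : ℕ := d * m with hN
    set ε : MvPowerSeries (Fin 2) k := Ψ - ψ N with hεdef
    have hεX : ∀ e : Fin 2 →₀ ℕ, e 1 ≠ 0 → coeff e ε = 0 := noY_sub hΨX (hψ N)
    have hε0 : constantCoeff ε = 0 := by rw [hεdef, map_sub, hΨ0, hψ0 N, sub_zero]
    have hεs : HasSubst ![X 0, X 1 + ε] := hasSubst_shear hε0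
    have hFε : F = subst ![X 0, X 1 + ε] (V N) * (X 1 + ε) ^ d +
        subst ![X 0, X 1 + ε] (R N) := by
      rw [hF, show Ψ = ε + ψ N by rw [hεdef, sub_add_cancel],
        ← shear_shear (hψ N) hε0 (hψ0 N) f, hTf N, subst_add hεs, subst_mul hεs,
        subst_pow hεs, subst_X hεs, shearFamily_apply_one]
    obtain ⟨Q, hQ⟩ : ε ∣ (X 1 + ε) ^ d - X 1 ^ d := by
      have h := sub_dvd_pow_sub_pow (X 1 + ε) (X 1 : MvPowerSeries (Fin 2) k) d
      rwa [add_sub_cancel_left] at h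
    have hexp : (X 1 + ε) ^ d = X 1 ^ d + ε * Q := by rw [← hQ]; ring
    have hmε : (m : ℕ∞) ≤ ε.order := htail N m le_rfl
    have hme : (e.degree : ℕ∞) < m := by exact_mod_cast Nat.lt_succ_self _
    have h1 : coeff e (subst ![X 0, X 1 + ε] (V N) * X 1 ^ d) = 0 :=
      (X_pow_dvd_iff.mp (dvd_mul_left _ _)) e he1
    have h2 : coeff e (subst ![X 0, X 1 + ε] (V N) * (ε * Q)) = 0 := by
      apply coeff_of_lt_order
      rw [mul_left_comm]
      calc (e.degree : ℕ∞) < m := hme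
        _ ≤ ε.order := hmε
        _ ≤ ε.order + (subst ![X 0, X 1 + ε] (V N) * Q).order := le_self_add
        _ ≤ _ := le_order_mul
    have h3 : coeff e (subst ![X 0, X 1 + ε] (R N)) = 0 := by
      apply coeff_of_lt_order
      calc (e.degree : ℕ∞) < m := hme
        _ ≤ N := by exact_mod_cast Nat.le_mul_of_pos_left m hd
        _ ≤ (R N).order := hR N
        _ ≤ _ := order_le_order_subst' _ (constantCoeff_shear hε0) _
    rw [hFε, hexp, mul_add, map_add, map_add, h1, h2, h3, add_zero, add_zero]
  obtain ⟨V', hV'⟩ : X 1 ^ d ∣ F := X_pow_dvd_iff.mpr hcoef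
  -- `ord F ≤ d`, so `V'(0) ≠ 0`
  have hnΨ0 : constantCoeff (-Ψ) = 0 := by rw [map_neg, hΨ0, neg_zero]
  have hnΨs : HasSubst ![X 0, X 1 + -Ψ] := hasSubst_shear hnΨ0
  have hfF : f = subst ![X 0, X 1 + -Ψ] F := by rw [hF, shear_neg_shear hΨX hΨ0 f]
  have hFd : F.order ≤ d :=
    calc F.order ≤ (subst ![X 0, X 1 + -Ψ] F).order :=
          order_le_order_subst' _ (constantCoeff_shear hnΨ0) _
      _ = d := by rw [← hfF, hfd]
  have hV'0 : constantCoeff V' ≠ 0 := by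
    intro h0
    have h1 : (1 : ℕ∞) ≤ V'.order := one_le_order_iff_constCoeff_eq_zero.mpr h0
    have h2 : (d : ℕ∞) + 1 ≤ F.order := by
      rw [hV']
      calc (d : ℕ∞) + 1 ≤ (X 1 ^ d).order + V'.order :=
            add_le_add (le_order_pow_of_constantCoeff_eq_zero d (constantCoeff_X 1)) h1
        _ ≤ _ := le_order_mul
    have h3 : (d : ℕ∞) + 1 ≤ d := h2.trans hFd
    have h4 : d + 1 ≤ d := by exact_mod_cast h3
    omega
  -- pull back along `T_{-Ψ}`
  have hfin : f = (X 1 + -Ψ) ^ d * subst ![X 0, X 1 + -Ψ] V' := by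
    rw [hfF, hV', subst_mul hnΨs, subst_pow hnΨs, subst_X hnΨs, shearFamily_apply_one]
  refine ⟨subst ![X 0, X 1 + -Ψ] V', X 1 + -Ψ, ?_, ?_, ⟨1, ?_⟩, ?_⟩
  · rwa [constantCoeff_subst_of_constantCoeff_zero _ (constantCoeff_shear hnΨ0)]
  · rw [map_add, constantCoeff_X, hnΨ0, add_zero]
  · rw [map_add, coeff_index_single_self_X, coeff_single_one_of_noY (noY_neg hΨX), add_zero]
    exact one_ne_zero
  · rw [hfin, mul_comm]

/-! ### 4. The swap `x ↔ y` -/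

/-- The components of a swap family `s = (y, x)` have zero constant terms. -/
theorem constantCoeff_swap {s : Fin 2 → MvPowerSeries (Fin 2) k} (hs0 : s 0 = X 1)
    (hs1 : s 1 = X 0) : ∀ i, constantCoeff (s i) = 0 := by
  intro i
  fin_cases i
  · show constantCoeff (s 0) = 0
    rw [hs0, constantCoeff_X]
  · show constantCoeff (s 1) = 0
    rw [hs1, constantCoeff_X]

/-- The swap is an involution. -/
theorem swap_swap {s : Fin 2 → MvPowerSeries (Fin 2) k} (hs0 : s 0 = X 1) (hs1 : s 1 = X 0)
    (g : MvPowerSeries (Fin 2) k) : subst s (subst s g) = g := by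
  have hs : HasSubst s := hasSubst_of_constantCoeff_zero (constantCoeff_swap hs0 hs1)
  rw [subst_comp_subst_apply hs hs]
  have h : (fun i => subst s (s i)) = X := by
    funext i
    fin_cases i
    · show subst s (s 0) = X 0
      rw [hs0, subst_X hs, hs1]
    · show subst s (s 1) = X 1
      rw [hs1, subst_X hs, hs0]
  rw [h, subst_self]
  rfl

/-- The swap preserves the order. -/
theorem order_swap {s : Fin 2 → MvPowerSeries (Fin 2) k} (hs0 : s 0 = X 1) (hs1 : s 1 = X 0)
    (g : MvPowerSeries (Fin 2) k) : (subst s g).order = g.order := by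
  refine le_antisymm ?_ (order_le_order_subst' _ (constantCoeff_swap hs0 hs1) g)
  calc (subst s g).order ≤ (subst s (subst s g)).order :=
        order_le_order_subst' _ (constantCoeff_swap hs0 hs1) _
    _ = g.order := by rw [swap_swap hs0 hs1]

/-- The swap exchanges the two linear coefficients. -/
theorem coeff_single_swap {s : Fin 2 → MvPowerSeries (Fin 2) k} (hs0 : s 0 = X 1)
    (hs1 : s 1 = X 0) (g : MvPowerSeries (Fin 2) k) (i j : Fin 2) (hij : i ≠ j) :
    coeff (Finsupp.single i 1) (subst s g) = coeff (Finsupp.single j 1) g := by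
  classical
  rw [CobordantArc.coeff_degree_one_subst s (constantCoeff_swap hs0 hs1) g _
    (Finsupp.degree_single _ _), Fin.sum_univ_two, hs0, hs1]
  fin_cases i <;> fin_cases j <;> simp [coeff_index_single_X] at hij ⊢

/-- MAIN LEMMA, `x`-slot version, by swapping the variables. -/
theorem main_slot_zero {f : MvPowerSeries (Fin 2) k} {d : ℕ} (hd : 1 ≤ d) (hfd : f.order = d)
    (hrep : ∀ N : ℕ, ∃ u L R : MvPowerSeries (Fin 2) k, constantCoeff u ≠ 0 ∧
      constantCoeff L = 0 ∧ coeff (Finsupp.single 0 1) L ≠ 0 ∧ f = u * L ^ d + R ∧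
      (N : ℕ∞) ≤ R.order) :
    ∃ u L : MvPowerSeries (Fin 2) k, constantCoeff u ≠ 0 ∧ constantCoeff L = 0 ∧
      (∃ i, coeff (Finsupp.single i 1) L ≠ 0) ∧ f = u * L ^ d := by
  obtain ⟨s, hs0, hs1⟩ : ∃ a : Fin 2 → MvPowerSeries (Fin 2) k, a 0 = X 1 ∧ a 1 = X 0 :=
    ⟨![X 1, X 0], rfl, rfl⟩
  have hsc := constantCoeff_swap hs0 hs1
  have hss : HasSubst s := hasSubst_of_constantCoeff_zero hsc
  have hrep' : ∀ N : ℕ, ∃ u L R : MvPowerSeries (Fin 2) k, constantCoeff u ≠ 0 ∧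
      constantCoeff L = 0 ∧ coeff (Finsupp.single 1 1) L ≠ 0 ∧
      subst s f = u * L ^ d + R ∧ (N : ℕ∞) ≤ R.order := by
    intro N
    obtain ⟨u, L, R, hu, hL0, hL1, hf, hR⟩ := hrep N
    refine ⟨subst s u, subst s L, subst s R, ?_, ?_, ?_, ?_, ?_⟩
    · rwa [constantCoeff_subst_of_constantCoeff_zero _ hsc]
    · rw [constantCoeff_subst_of_constantCoeff_zero _ hsc, hL0]
    · rwa [coeff_single_swap hs0 hs1 L 1 0 (by decide)]
    · rw [hf, subst_add hss, subst_mul hss, subst_pow hss]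
    · exact hR.trans (order_le_order_subst' _ hsc R)
  obtain ⟨u, L, hu, hL0, ⟨i, hi⟩, hf⟩ :=
    main_slot hd ((order_swap hs0 hs1 f).trans hfd) hrep'
  refine ⟨subst s u, subst s L, ?_, ?_, ?_, ?_⟩
  · rwa [constantCoeff_subst_of_constantCoeff_zero _ hsc]
  · rw [constantCoeff_subst_of_constantCoeff_zero _ hsc, hL0]
  · fin_cases i
    · exact ⟨1, by rwa [coeff_single_swap hs0 hs1 L 1 0 (by decide)]⟩
    · exact ⟨0, by rwa [coeff_single_swap hs0 hs1 L 0 1 (by decide)]⟩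
  · rw [← swap_swap hs0 hs1 f, hf, subst_mul hss, subst_pow hss]

end ApproxPowerExact

/-- APPROXIMATE `d`-TH POWERS TO ALL ORDERS ⇒ EXACT `d`-TH POWER (plane germs, every field; the
closedness of `{u·L^d}`).  If `f` of order `d` is, for every `N`, of the form `u_N·L_N^d + R_N` with `u_N`
a unit, `L_N` smooth and `ord R_N ≥ N`, then `f = u·L^d` with `u` a unit and `L` smooth.  (Implicit
function normal form `L_N = unit·(y − ψ_N(x))` for a cofinal family; restricting to `y = ψ_M(x)` gives
`ord(ψ_M − ψ_N) ≥ N/d`, so the `ψ_N` converge `x`-adically to `ψ`; then every coefficient of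
`f(x, ψ(x) + t)` off `t^d·k[[x,t]]` vanishes.) -/
theorem stub_approxPowerExact : ∀ (k : Type) [Field k] (f : MvPowerSeries (Fin 2) k) (d : ℕ), f.order = d →
    (∀ N : ℕ, ∃ (u L R : MvPowerSeries (Fin 2) k), MvPowerSeries.constantCoeff u ≠ 0 ∧
      MvPowerSeries.constantCoeff L = 0 ∧ (∃ i, MvPowerSeries.coeff (Finsupp.single i 1) L ≠ 0) ∧
      f = u * L ^ d + R ∧ ((N : ℕ) : ℕ∞) ≤ R.order) →
    ∃ (u L : MvPowerSeries (Fin 2) k), MvPowerSeries.constantCoeff u ≠ 0 ∧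
      MvPowerSeries.constantCoeff L = 0 ∧ (∃ i, MvPowerSeries.coeff (Finsupp.single i 1) L ≠ 0) ∧
      f = u * L ^ d := by
  intro k _ f d hfd hrep
  rcases Nat.eq_zero_or_pos d with hd | hd
  · -- `d = 0`: `f` is a unit
    subst hd
    refine ⟨f, MvPowerSeries.X 0, ?_, MvPowerSeries.constantCoeff_X 0, ⟨0, ?_⟩, ?_⟩
    · intro h0
      have h := MvPowerSeries.order_ne_zero_iff_constCoeff_eq_zero.mpr h0
      rw [hfd] at h
      exact h (by simp)
    · rw [MvPowerSeries.coeff_index_single_self_X]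
      exact one_ne_zero
    · rw [pow_zero, mul_one]
  · by_cases h1 : ∀ N : ℕ, ∃ u L R : MvPowerSeries (Fin 2) k,
        MvPowerSeries.constantCoeff u ≠ 0 ∧ MvPowerSeries.constantCoeff L = 0 ∧
        MvPowerSeries.coeff (Finsupp.single 1 1) L ≠ 0 ∧ f = u * L ^ d + R ∧
        (N : ℕ∞) ≤ R.order
    · exact ApproxPowerExact.main_slot hd hfd h1
    · -- the `y`-slot fails at some level `N₀`, so the `x`-slot works at every level
      push Not at h1
      obtain ⟨N₀, hN₀⟩ := h1
      refine ApproxPowerExact.main_slot_zero hd hfd fun N => ?_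
      obtain ⟨u, L, R, hu, hL, ⟨i, hi⟩, hf, hR⟩ := hrep (max N N₀)
      have hR₀ : ((N₀ : ℕ) : ℕ∞) ≤ R.order :=
        le_trans (by exact_mod_cast le_max_right N N₀) hR
      have hRN : ((N : ℕ) : ℕ∞) ≤ R.order :=
        le_trans (by exact_mod_cast le_max_left N N₀) hR
      have hi1 : MvPowerSeries.coeff (Finsupp.single 1 1) L = 0 := by
        by_contra hne
        exact absurd hR₀ (not_le.mpr (hN₀ u L R hu hL hne hf))
      fin_cases i
      · exact ⟨u, L, R, hu, hL, hi, hf, hRN⟩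
      · exact absurd hi1 hi

end Summit.ResolutionOfSingularities.ResolutionOfSingularities.Theorems
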